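import Literature.Analysis.FluidPDE.SteadyNSLiouvilleReduction
import Literature.Analysis.FluidPDE.ShellOscillation
import Literature.Analysis.FluidPDE.SteadyNSLocalEnergy
import Literature.Analysis.FluidPDE.SteadyNSPressureSplit
import Literature.Analysis.FluidPDE.SteadyNSHarmonicPressureGradient
import Literature.Analysis.FluidPDE.SteadyNSCaccioppoliTools
import HarnessLib

/-!
# Seregin–Wang 2020, Thm 1.1 (i), `q = ℓ = 3`: the Caccioppoli-type inequality and the discharge

Analysis/FluidPDE proof file (everything PROVED; no definitions, no named facts; a sibling of
`SteadyNSLiouvilleProofs.lean`, which holds the Wang–Yang reduction to this fact).  This file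
**discharges** the named fact `Literature.Analysis.FluidPDE.sereginWang_liouville_L3_annulus`
(`SteadyNSLiouville.lean`; G. Seregin, W. Wang, *Sufficient conditions on Liouville type
theorems for the 3D steady Navier–Stokes equations*, Algebra i Analiz 31 (2019) = St. Petersburg
Math. J. 31 (2020), Thm 1.1 (i), case `q = ℓ = 3` = arXiv:1805.02227):
`sereginWang_liouville_L3_annulus_holds`.

By `SteadyNSLiouvilleReduction` (the printed §3) it remains to prove the Caccioppoli-type
inequality of Seregin–Wang's Prop. 2.1 for `q = ℓ = 3` (after Hölder on the annulus):

  `∫_{B(R/2)} |∇u|² ≤ C R⁻¹ (‖u‖²_{L³(A_R)} + ‖u‖³_{L³(A_R)})`,  `A_R = {R/2 ≤ |x| < R}`,   (C₃)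

for every smooth solution of `−Δu + (u·∇)u + ∇p = 0`, `div u = 0` on `ℝ³` and every `R > 0`,
with one constant `C` (`exists_caccioppoli_L3_annulus`).

## The proof of (C₃) given here

The printed proof tests the equations with `φu − w`, `w` a Bogovskiĭ corrector killing the
pressure, and runs a hole-filling iteration; the tree has no Bogovskiĭ operator.  We test with
`φu` only (`φ = φ_R` the energy cut-off of `SteadyNSCaccioppoliTools`: `= 1` on `B(3R/4)`,
`Dφ`, `Δφ` supported in the shell `S₀ = {3R/4 ≤ |x| ≤ 7R/8} ⊆ A_R`, `|Dφ| ≤ C₁/R`,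
`|Δφ| ≤ C₂/R²`) and keep the pressure:

  `∫ φ|∇u|² = ½∫ Δφ |u|² + ½∫ (Dφ·u)|u|² + ∫ (p − c)(Dφ·u)`     (`SteadyNSLocalEnergy`),

where `a := ‖u‖_{L³(A_R)}` controls the first two terms by `R⁻¹a²` and `R⁻¹a³` (Hölder on
`S₀`, `|S₀| ≤ |B₁|R³`).  For the pressure term we split `p − c = p̃[χu] + (h − c)` near the
annulus (`SteadyNSPressureSplit`: `χ = χ_R` a cut-off of `A_R`, `p̃` the Riesz-transform pressure,
`h` harmonic on `U_R = {5R/8 < |x| < 31R/32} ⊇ S₀`):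
* `|∫ p̃[χu](Dφ·u)| ≤ C₁R⁻¹ ‖p̃[χu]‖_{3/2} a ≤ C₁ C_S R⁻¹ a³` by **Stein's theorem**
  `‖p̃[w]‖_{3/2} ≤ C_S‖w‖²_3` (PROVED in the tree by Calderón–Zygmund theory) and `‖χu‖_3 ≤ a`;
* `|∫ (h − h(x₀))(Dφ·u)| ≤ C₁R⁻¹ · osc_{S₀} h · ∫_{S₀}|u|`, with `∫_{S₀}|u| ≤ a |S₀|^{2/3} ≲ R²a`
  and `osc_{S₀} h ≤ 4R · sup_{S₀}|∇h|` (`ShellOscillation`: radial segment + great-circle arc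
  inside the shell), and the interior gradient estimate of `SteadyNSHarmonicPressureGradient`
  on balls `B(z, R/32) ⊆ U_R` (mean value property for `∂ₐh`, the equations, integration by
  parts): `sup_{S₀}|∇h| ≲ R⁻³ (a + a² + ‖p̃[χu]‖_{3/2}) ≲ R⁻³(a + a²)`.
Altogether `∫ φ|∇u|² ≤ R⁻¹ (M₂ a² + M₃ a³)` with absolute `M₂, M₃` — a genuinely scale-invariant
estimate, so no iteration is needed — and `∫_{B(R/2)}|∇u|² ≤ ∫ φ|∇u|²`.

## References

* G. Seregin, W. Wang, St. Petersburg Math. J. 31 (2020) 387–393 = Algebra i Analiz 31 (2019)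
  269–278 = arXiv:1805.02227: Thm 1.1 (i), Prop. 2.1, §3. [`SereginWang2020`]
* W. Wang, *Liouville theorems for the steady Navier–Stokes equations* (Science Press, 2025),
  Thm 2.4 (i), Prop. 2.1 (2.16). [`Wang2025`]
* E. M. Stein, *Singular integrals and differentiability properties of functions* (1970),
  Ch. II §4.2 Thm 3. [`Stein1971`]
-/

noncomputable section

open MeasureTheory Set Filter Topology InnerProductSpace Function Metric Bornology
open scoped RealInnerProductSpace Laplacian ENNReal NNReal ContDiff

namespace Literature.Analysis.FluidPDE

/-! ### Small helpers -/

/-- `|∫ g| ≤ ∫_K G` when `g` vanishes off `K` and `|g| ≤ G` on `K`, `G` integrable on `K`.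
[folklore] -/
theorem abs_integral_le_setIntegral_of_le {E : Type*} [MeasurableSpace E] {μ : Measure E}
    {g G : E → ℝ} {K : Set E} (h0 : ∀ x ∉ K, g x = 0) (hle : ∀ x ∈ K, |g x| ≤ G x)
    (hK : MeasurableSet K) (hG : IntegrableOn G K μ) : |∫ x, g x ∂μ| ≤ ∫ x in K, G x ∂μ := by
  rw [← setIntegral_eq_integral_of_forall_compl_eq_zero (s := K) h0]
  calc |∫ x in K, g x ∂μ| ≤ ∫ x in K, |g x| ∂μ := abs_integral_le_integral_abs
    _ ≤ ∫ x in K, G x ∂μ :=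
        integral_mono_of_nonneg (Eventually.of_forall fun x => abs_nonneg _) hG
          ((ae_restrict_iff' hK).2 (Eventually.of_forall hle))

/-- `V^{1/3} ≤ r |B₁|^{1/3}` and `V^{2/3} ≤ r² |B₁|^{2/3}` when `0 ≤ V ≤ r³ |B₁|`. [folklore] -/
theorem rpow_le_of_le_cube_mul {V r B : ℝ} (hV : 0 ≤ V) (hr : 0 ≤ r) (hB : 0 ≤ B)
    (h : V ≤ r ^ 3 * B) :
    V ^ (1 / 3 : ℝ) ≤ r * B ^ (1 / 3 : ℝ) ∧ V ^ (1 / (3 / 2) : ℝ) ≤ r ^ 2 * B ^ (1 / (3 / 2) : ℝ) := by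
  have h3 : (r ^ 3 : ℝ) = r ^ (3 : ℝ) := by rw [← Real.rpow_natCast]; norm_num
  constructor
  · calc V ^ (1 / 3 : ℝ) ≤ (r ^ 3 * B) ^ (1 / 3 : ℝ) := Real.rpow_le_rpow hV h (by norm_num)
      _ = r * B ^ (1 / 3 : ℝ) := by
          rw [Real.mul_rpow (by positivity) hB, h3, ← Real.rpow_mul hr]
          norm_num
  · calc V ^ (1 / (3 / 2) : ℝ) ≤ (r ^ 3 * B) ^ (1 / (3 / 2) : ℝ) :=
          Real.rpow_le_rpow hV h (by norm_num)
      _ = r ^ 2 * B ^ (1 / (3 / 2) : ℝ) := by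
          rw [Real.mul_rpow (by positivity) hB, h3, ← Real.rpow_mul hr]
          have : (3 : ℝ) * (1 / (3 / 2)) = 2 := by norm_num
          rw [this]
          norm_cast

/-- `((I)^{1/3})³ = I` and `((I)^{1/3})² = I^{2/3}` for `I ≥ 0`. [folklore] -/
theorem rpow_third_pow {I : ℝ} (hI : 0 ≤ I) :
    (I ^ (1 / 3 : ℝ)) ^ 3 = I ∧ (I ^ (1 / 3 : ℝ)) ^ 2 = I ^ (1 / (3 / 2) : ℝ) := by
  constructor
  · rw [← Real.rpow_natCast, ← Real.rpow_mul hI]; norm_num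
  · rw [← Real.rpow_natCast, ← Real.rpow_mul hI]; norm_num

/-! ### The Caccioppoli-type inequality -/

/-- **The gradient of the harmonic part on the shell `S₀ = {3R/4 ≤ |z| ≤ 7R/8}`** (Step 1 of the
proof of `exists_caccioppoli_L3_annulus`): the interior gradient estimate of
`SteadyNSHarmonicPressureGradient` on the balls `B(z, R/32) ⊆ U_R ∩ A_R`, `s = R/64`, with the
ball integrals bounded by Hölder: `‖∇h(z)‖ ≤ K R⁻³ (c₁ a + c₂ (a² + P))`,
`c₁ = 2²⁰|B₁|^{2/3}`, `c₂ = 2¹⁹|B₁|^{1/3}`, where `a` dominates `‖u‖_{L³(S)}` for `S ⊆ A_R` and `P`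
dominates `‖q‖_{L^{3/2}(S)}`. [folklore] -/
theorem norm_fderiv_harmonicPart_le_on_shell {K : ℝ} (hK0 : 0 ≤ K)
    (hK : ∀ (u : EuclideanSpace ℝ (Fin 3) → EuclideanSpace ℝ (Fin 3))
      (p : EuclideanSpace ℝ (Fin 3) → ℝ), IsLerayProfile 1 0 u p → ContDiff ℝ ∞ u →
      ContDiff ℝ ∞ p → ∀ χ : EuclideanSpace ℝ (Fin 3) → ℝ, ContDiff ℝ ∞ χ → HasCompactSupport χ →
      ∀ U : Set (EuclideanSpace ℝ (Fin 3)), IsOpen U → (∀ y ∈ U, χ y = 1) →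
      ∀ s : ℝ, 0 < s → ∀ x : EuclideanSpace ℝ (Fin 3), ball x (2 * s) ⊆ U →
        ‖fderiv ℝ (fun y => p y - normalisedPressure (fun z => χ z • u z) y) x‖ ≤
          K * (s⁻¹ ^ 5 * (∫ z in closedBall x (2 * s), ‖u z‖) +
            s⁻¹ ^ 4 * ((∫ z in closedBall x (2 * s), ‖u z‖ ^ 2) +
              ∫ z in closedBall x (2 * s), ‖normalisedPressure (fun z => χ z • u z) z‖)))
    {u : EuclideanSpace ℝ (Fin 3) → EuclideanSpace ℝ (Fin 3)} {p : EuclideanSpace ℝ (Fin 3) → ℝ}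
    (hprof : IsLerayProfile 1 0 u p) (hu : ContDiff ℝ ∞ u) (hp : ContDiff ℝ ∞ p)
    {χ : EuclideanSpace ℝ (Fin 3) → ℝ} (hχs : ContDiff ℝ ∞ χ) (hχc : HasCompactSupport χ)
    {R : ℝ} (hR : 0 < R)
    (hχU : ∀ y ∈ {x : EuclideanSpace ℝ (Fin 3) | 5 * R / 8 < ‖x‖ ∧ ‖x‖ < 31 * R / 32}, χ y = 1)
    {a P : ℝ} (ha0 : 0 ≤ a) (hP0 : 0 ≤ P)
    (hthird : ∀ S ⊆ {x : EuclideanSpace ℝ (Fin 3) | R / 2 ≤ ‖x‖ ∧ ‖x‖ < R},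
      (∫ x in S, ‖u x‖ ^ (3 : ℝ)) ^ (1 / 3 : ℝ) ≤ a)
    (htwothird : ∀ S ⊆ {x : EuclideanSpace ℝ (Fin 3) | R / 2 ≤ ‖x‖ ∧ ‖x‖ < R},
      (∫ x in S, ‖u x‖ ^ (3 : ℝ)) ^ (1 / (3 / 2) : ℝ) ≤ a ^ 2)
    (hPmono : ∀ S : Set (EuclideanSpace ℝ (Fin 3)),
      (∫ x in S, |normalisedPressure (fun z => χ z • u z) x| ^ (3 / 2 : ℝ)) ^ (1 / (3 / 2) : ℝ) ≤ P)
    {z : EuclideanSpace ℝ (Fin 3)} (hz1 : 3 * R / 4 ≤ ‖z‖) (hz2 : ‖z‖ ≤ 7 * R / 8) :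
    ‖fderiv ℝ (fun y => p y - normalisedPressure (fun x => χ x • u x) y) z‖ ≤
      K * R⁻¹ ^ 3 * (2 ^ 20 * (volume.real (ball (0 : EuclideanSpace ℝ (Fin 3)) 1)) ^
        (1 / (3 / 2) : ℝ) * a + 2 ^ 19 * (volume.real (ball (0 : EuclideanSpace ℝ (Fin 3)) 1)) ^
          (1 / 3 : ℝ) * (a ^ 2 + P)) := by
  set V₁ : ℝ := volume.real (ball (0 : EuclideanSpace ℝ (Fin 3)) 1) with hV₁
  have hV₁0 : 0 ≤ V₁ := measureReal_nonneg
  set q : EuclideanSpace ℝ (Fin 3) → ℝ := normalisedPressure (fun x => χ x • u x) with hq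
  have huc : Continuous u := (contDiff_infty.1 hu 0).continuous
  have hqc : Continuous q :=
    (contDiff_infty.1 (contDiff_normalisedPressure_of_contDiff_infty (hχs.smul hu)
      hχc.smul_right) 0).continuous
  have hAb : IsBounded {x : EuclideanSpace ℝ (Fin 3) | R / 2 ≤ ‖x‖ ∧ ‖x‖ < R} :=
    isBounded_closedBall.subset fun x hx => mem_closedBall_zero_iff.2 hx.2.le
  set s : ℝ := R / 64 with hs
  have hs0 : 0 < s := by positivity
  have h2s : 2 * s = R / 32 := by rw [hs]; ring
  have hUo : IsOpen {x : EuclideanSpace ℝ (Fin 3) | 5 * R / 8 < ‖x‖ ∧ ‖x‖ < 31 * R / 32} :=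
    (isOpen_lt continuous_const continuous_norm).inter (isOpen_lt continuous_norm continuous_const)
  -- the ball `B(z, R/32)` lies in `U` and in `A`
  have hballU : ball z (2 * s) ⊆
      {x : EuclideanSpace ℝ (Fin 3) | 5 * R / 8 < ‖x‖ ∧ ‖x‖ < 31 * R / 32} := fun y hy => by
    rw [h2s, mem_ball, dist_eq_norm] at hy
    have h1 := norm_sub_norm_le y z
    have h2 := norm_sub_norm_le z y
    rw [norm_sub_rev] at h2
    exact ⟨by linarith, by linarith⟩
  have hBA : closedBall z (2 * s) ⊆ {x : EuclideanSpace ℝ (Fin 3) | R / 2 ≤ ‖x‖ ∧ ‖x‖ < R} :=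
    fun y hy => by
    rw [h2s, mem_closedBall, dist_eq_norm] at hy
    have h1 := norm_sub_norm_le y z
    have h2 := norm_sub_norm_le z y
    rw [norm_sub_rev] at h2
    exact ⟨by linarith, by linarith⟩
  have hBb : IsBounded (closedBall z (2 * s)) := isBounded_closedBall
  have hVB : volume.real (closedBall z (2 * s)) = (R / 32) ^ 3 * V₁ := by
    rw [h2s, volume_real_closedBall_eq z (by positivity : (0 : ℝ) ≤ R / 32),
      finrank_euclideanSpace, Fintype.card_fin]
  obtain ⟨hVB13, hVB23⟩ := rpow_le_of_le_cube_mul (measureReal_nonneg (μ := volume)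
    (s := closedBall z (2 * s))) (by positivity : (0 : ℝ) ≤ R / 32) hV₁0 hVB.le
  -- the three ball integrals
  have hJ1 : ∫ y in closedBall z (2 * s), ‖u y‖ ≤ a * ((R / 32) ^ 2 * V₁ ^ (1 / (3 / 2) : ℝ)) := by
    refine (setIntegral_norm_le_rpow_three huc hBb).trans ?_
    exact mul_le_mul (hthird _ hBA) hVB23 (Real.rpow_nonneg measureReal_nonneg _) ha0
  have hJ2 : ∫ y in closedBall z (2 * s), ‖u y‖ ^ 2 ≤ a ^ 2 * (R / 32 * V₁ ^ (1 / 3 : ℝ)) := by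
    refine (setIntegral_norm_sq_le_rpow_three huc hBb).trans ?_
    exact mul_le_mul (htwothird _ hBA) hVB13 (Real.rpow_nonneg measureReal_nonneg _)
      (sq_nonneg a)
  have hJ3 : ∫ y in closedBall z (2 * s), ‖q y‖ ≤ P * (R / 32 * V₁ ^ (1 / 3 : ℝ)) := by
    obtain ⟨e, he⟩ : ∃ e : EuclideanSpace ℝ (Fin 3), ‖e‖ = 1 := exists_norm_eq _ zero_le_one
    have h1 := setIntegral_mul_norm_le_rpow hqc (continuous_const (y := e)) hBb
    have hconst : (∫ y in closedBall z (2 * s), ‖e‖ ^ (3 : ℝ)) =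
        volume.real (closedBall z (2 * s)) := by
      rw [he, Real.one_rpow, setIntegral_const, smul_eq_mul, mul_one]
    rw [hconst] at h1
    have hone : ∫ y in closedBall z (2 * s), |q y| * ‖e‖ = ∫ y in closedBall z (2 * s), ‖q y‖ :=
      integral_congr_ae (Eventually.of_forall fun y => by
        show |q y| * ‖e‖ = ‖q y‖
        rw [he, mul_one, Real.norm_eq_abs])
    rw [hone] at h1
    exact h1.trans (mul_le_mul (hPmono _) hVB13 (Real.rpow_nonneg measureReal_nonneg _) hP0)
  have hmain := hK u p hprof hu hp χ hχs hχc _ hUo hχU s hs0 z hballU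
  refine hmain.trans ?_
  have hstep : K * (s⁻¹ ^ 5 * (∫ y in closedBall z (2 * s), ‖u y‖) +
        s⁻¹ ^ 4 * ((∫ y in closedBall z (2 * s), ‖u y‖ ^ 2) +
          ∫ y in closedBall z (2 * s), ‖q y‖)) ≤
      K * (s⁻¹ ^ 5 * (a * ((R / 32) ^ 2 * V₁ ^ (1 / (3 / 2) : ℝ))) +
        s⁻¹ ^ 4 * (a ^ 2 * (R / 32 * V₁ ^ (1 / 3 : ℝ)) + P * (R / 32 * V₁ ^ (1 / 3 : ℝ)))) := by
    have hs5 : 0 ≤ s⁻¹ ^ 5 := by positivity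
    have hs4 : 0 ≤ s⁻¹ ^ 4 := by positivity
    refine mul_le_mul_of_nonneg_left ?_ hK0
    exact add_le_add (mul_le_mul_of_nonneg_left hJ1 hs5)
      (mul_le_mul_of_nonneg_left (add_le_add hJ2 hJ3) hs4)
  refine hstep.trans (le_of_eq ?_)
  rw [hs]
  field_simp
  ring


set_option maxHeartbeats 800000 in
-- four elementary estimates with many integrability side conditions
/-- **The real-variable core of the Caccioppoli estimate** (Steps 2–4 of the proof of
`exists_caccioppoli_L3_annulus`): given the energy cut-off `φ` at scale `R` (with the bounds
`‖Dφ‖ ≤ C₁R⁻¹`, `|Δφ| ≤ C₂R⁻²` and `Dφ = Δφ = 0` off the shell `S₀ = {3R/4 ≤ |x| ≤ 7R/8}`), a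
cut-off `χ ∈ C_c^∞`, a bound `G` for `‖∇(p − p̃[χu])‖` on `S₀`, and numbers `a`, `P` dominating
`‖u‖_{L³(S₀)}` and `‖p̃[χu]‖_{L^{3/2}(S₀)}`, the localised energy satisfies
`∫ φ|∇u|² ≤ ½C₂R⁻¹|B₁|^{1/3} a² + ½C₁R⁻¹a³ + C₁R⁻¹ P a + 4C₁ |B₁|^{2/3} R² G a`
(energy identity of `SteadyNSLocalEnergy`, shift of the pressure by the constant `h(x₀)`,
splitting `p − h(x₀) = p̃[χu] + (h − h(x₀))`, Hölder on `S₀` and the shell oscillation bound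
`|h(x) − h(x₀)| ≤ 4RG` of `ShellOscillation`). [cite: SereginWang2020, proof of Prop. 2.1] -/
theorem energy_real_bound
    {u : EuclideanSpace ℝ (Fin 3) → EuclideanSpace ℝ (Fin 3)} {p : EuclideanSpace ℝ (Fin 3) → ℝ}
    (hprof : IsLerayProfile 1 0 u p) (hu : ContDiff ℝ ∞ u) (hp : ContDiff ℝ ∞ p)
    {χ : EuclideanSpace ℝ (Fin 3) → ℝ} (hχs : ContDiff ℝ ∞ χ) (hχc : HasCompactSupport χ)
    {R C₁ C₂ : ℝ} (hR : 0 < R) (hC₁ : 0 ≤ C₁) (hC₂ : 0 ≤ C₂)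
    {φ : EuclideanSpace ℝ (Fin 3) → ℝ} (hφs : ContDiff ℝ ∞ φ) (hφc : HasCompactSupport φ)
    (hDφ : ∀ x, ‖fderiv ℝ φ x‖ ≤ C₁ * R⁻¹) (hΔφ : ∀ x, |(Δ φ) x| ≤ C₂ * R⁻¹ ^ 2)
    (hφvan : ∀ x : EuclideanSpace ℝ (Fin 3), ‖x‖ < 3 * R / 4 ∨ 7 * R / 8 < ‖x‖ →
      fderiv ℝ φ x = 0 ∧ (Δ φ) x = 0)
    {a P G : ℝ} (ha0 : 0 ≤ a) (hP0 : 0 ≤ P) (hG0 : 0 ≤ G)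
    (hmonoS₀ : ∫ x in {x : EuclideanSpace ℝ (Fin 3) | 3 * R / 4 ≤ ‖x‖ ∧ ‖x‖ ≤ 7 * R / 8},
      ‖u x‖ ^ (3 : ℝ) ≤ a ^ 3)
    (hthirdS₀ : (∫ x in {x : EuclideanSpace ℝ (Fin 3) | 3 * R / 4 ≤ ‖x‖ ∧ ‖x‖ ≤ 7 * R / 8},
      ‖u x‖ ^ (3 : ℝ)) ^ (1 / 3 : ℝ) ≤ a)
    (htwothirdS₀ : (∫ x in {x : EuclideanSpace ℝ (Fin 3) | 3 * R / 4 ≤ ‖x‖ ∧ ‖x‖ ≤ 7 * R / 8},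
      ‖u x‖ ^ (3 : ℝ)) ^ (1 / (3 / 2) : ℝ) ≤ a ^ 2)
    (hPmonoS₀ : (∫ x in {x : EuclideanSpace ℝ (Fin 3) | 3 * R / 4 ≤ ‖x‖ ∧ ‖x‖ ≤ 7 * R / 8},
      |normalisedPressure (fun z => χ z • u z) x| ^ (3 / 2 : ℝ)) ^ (1 / (3 / 2) : ℝ) ≤ P)
    (hgrad : ∀ z : EuclideanSpace ℝ (Fin 3), 3 * R / 4 ≤ ‖z‖ → ‖z‖ ≤ 7 * R / 8 →
      ‖fderiv ℝ (fun y => p y - normalisedPressure (fun x => χ x • u x) y) z‖ ≤ G) :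
    ∫ x, φ x * frobeniusNormSq (fderiv ℝ u x) ≤
      2⁻¹ * (C₂ * R⁻¹ ^ 2 * (a ^ 2 * (R * (volume.real (ball (0 : EuclideanSpace ℝ (Fin 3)) 1)) ^
        (1 / 3 : ℝ)))) + 2⁻¹ * (C₁ * R⁻¹ * a ^ 3) + C₁ * R⁻¹ * (P * a) +
        C₁ * R⁻¹ * (G * (4 * R)) * (a * (R ^ 2 * (volume.real (ball (0 : EuclideanSpace ℝ (Fin 3))
          1)) ^ (1 / (3 / 2) : ℝ))) := by
  set V₁ : ℝ := volume.real (ball (0 : EuclideanSpace ℝ (Fin 3)) 1) with hV₁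
  have hV₁0 : 0 ≤ V₁ := measureReal_nonneg
  set S₀ : Set (EuclideanSpace ℝ (Fin 3)) := {x | 3 * R / 4 ≤ ‖x‖ ∧ ‖x‖ ≤ 7 * R / 8} with hS₀
  have hS₀sub : S₀ ⊆ closedBall (0 : EuclideanSpace ℝ (Fin 3)) R := fun x hx =>
    mem_closedBall_zero_iff.2 (by linarith [hx.2])
  have hS₀b : IsBounded S₀ := isBounded_closedBall.subset hS₀sub
  have hS₀m : MeasurableSet S₀ :=
    (measurableSet_le measurable_const measurable_norm).inter
      (measurableSet_le measurable_norm measurable_const)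
  have hS₀cpt : IsCompact S₀ :=
    (isCompact_closedBall (0 : EuclideanSpace ℝ (Fin 3)) R).of_isClosed_subset
      ((isClosed_le continuous_const continuous_norm).inter
        (isClosed_le continuous_norm continuous_const)) hS₀sub
  -- volumes
  have hVS₀ : volume.real S₀ ≤ R ^ 3 * V₁ := by
    have := volume_real_le_of_subset_closedBall hR.le hS₀sub
    rwa [finrank_euclideanSpace, Fintype.card_fin] at this
  obtain ⟨hVS₀13, hVS₀23⟩ := rpow_le_of_le_cube_mul (measureReal_nonneg (μ := volume) (s := S₀))
    hR.le hV₁0 hVS₀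
  -- regularity
  have huc : Continuous u := (contDiff_infty.1 hu 0).continuous
  have hu1 : ContDiff ℝ 1 u := contDiff_infty.1 hu 1
  set q : EuclideanSpace ℝ (Fin 3) → ℝ := normalisedPressure (fun x => χ x • u x) with hq
  set h : EuclideanSpace ℝ (Fin 3) → ℝ := fun x => p x - q x with hh
  have hws : ContDiff ℝ ∞ (fun x => χ x • u x) := hχs.smul hu
  have hwc : HasCompactSupport (fun x => χ x • u x) := hχc.smul_right
  have hqs : ContDiff ℝ ∞ q := contDiff_normalisedPressure_of_contDiff_infty hws hwc
  have hqc : Continuous q := (contDiff_infty.1 hqs 0).continuous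
  have hhs : ContDiff ℝ ∞ h := contDiff_pressure_sub_normalisedPressure hu hp hχs hχc
  have hhd : Differentiable ℝ h := (contDiff_infty.1 hhs 1).differentiable one_ne_zero
  ----------------------------------------------------------------
  -- Step 2: oscillation of `h` over the shell
  ----------------------------------------------------------------
  obtain ⟨x₀, hx₀⟩ : ∃ x₀ : EuclideanSpace ℝ (Fin 3), ‖x₀‖ = 13 * R / 16 :=
    exists_norm_eq _ (by positivity)
  have hx₀S : x₀ ∈ S₀ := by rw [hS₀, mem_setOf_eq, hx₀]; constructor <;> linarith
  have hE3 : 2 ≤ Module.finrank ℝ (EuclideanSpace ℝ (Fin 3)) := by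
    rw [finrank_euclideanSpace, Fintype.card_fin]; norm_num
  have hosc : ∀ x ∈ S₀, |h x - h x₀| ≤ G * (4 * R) := by
    intro x hx
    have h1 := abs_sub_le_of_norm_fderiv_le_shell hE3 hhd (by positivity : 0 < 3 * R / 4) hgrad
      hx.1 hx.2 hx₀S.1 hx₀S.2
    refine h1.trans (mul_le_mul_of_nonneg_left ?_ hG0)
    nlinarith [Real.pi_le_four, Real.pi_pos]
  ----------------------------------------------------------------
  -- Step 3: the localised energy identity and the four estimates
  ----------------------------------------------------------------
  have hφ2 : ContDiff ℝ 2 φ := contDiff_infty.1 hφs 2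
  have hφ1' : ContDiff ℝ 1 φ := contDiff_infty.1 hφs 1
  have hφcn : Continuous φ := hφ1'.continuous
  have hDφc : Continuous (fderiv ℝ φ) := hφ1'.continuous_fderiv one_ne_zero
  have hpc : Continuous p := (contDiff_infty.1 hp 0).continuous
  have hhc : Continuous h := hhd.continuous
  have henergy := hprof.integral_mul_frobeniusNormSq_eq hφ2 hφc
  have hzero := hprof.integral_fderiv_apply_velocity_eq_zero hφ1' hφc
  -- vanishing off the shell
  have hvanD : ∀ x ∉ S₀, fderiv ℝ φ x = 0 := fun x hx => by
    refine (hφvan x ?_).1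
    simp only [hS₀, mem_setOf_eq, not_and_or, not_le] at hx
    exact hx
  have hvanΔ : ∀ x ∉ S₀, (Δ φ) x = 0 := fun x hx => by
    refine (hφvan x ?_).2
    simp only [hS₀, mem_setOf_eq, not_and_or, not_le] at hx
    exact hx
  -- integrability of the pieces of the pressure term
  have hDφcs : HasCompactSupport (fderiv ℝ φ) := hφc.fderiv (𝕜 := ℝ)
  have hcsD : ∀ f : EuclideanSpace ℝ (Fin 3) → ℝ,
      HasCompactSupport fun x => f x * fderiv ℝ φ x (u x) := fun f =>
    hDφcs.mono fun x hx => by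
      rw [mem_support] at hx ⊢
      contrapose! hx
      simp [hx]
  have hcontD : ∀ {f : EuclideanSpace ℝ (Fin 3) → ℝ}, Continuous f →
      Continuous fun x => f x * fderiv ℝ φ x (u x) := fun hf => hf.mul (hDφc.clm_apply huc)
  have hIp : Integrable fun x => p x * fderiv ℝ φ x (u x) :=
    (hcontD hpc).integrable_of_hasCompactSupport (hcsD p)
  have hIq : Integrable fun x => q x * fderiv ℝ φ x (u x) :=
    (hcontD hqc).integrable_of_hasCompactSupport (hcsD q)
  have hIh : Integrable fun x => (h x - h x₀) * fderiv ℝ φ x (u x) :=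
    (hcontD (hhc.sub continuous_const)).integrable_of_hasCompactSupport (hcsD _)
  have hI1 : Integrable fun x => fderiv ℝ φ x (u x) := by
    have : Integrable fun x => (1 : ℝ) * fderiv ℝ φ x (u x) :=
      (hcontD (continuous_const : Continuous fun _ : EuclideanSpace ℝ (Fin 3) => (1 : ℝ)))
        |>.integrable_of_hasCompactSupport (hcsD _)
    simpa using this
  -- the pressure term split: `∫ p Dφ·u = ∫ q Dφ·u + ∫ (h - h x₀) Dφ·u`
  have hsplit : ∫ x, p x * fderiv ℝ φ x (u x) =
      (∫ x, q x * fderiv ℝ φ x (u x)) + ∫ x, (h x - h x₀) * fderiv ℝ φ x (u x) := by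
    rw [← integral_add hIq hIh]
    have : ∫ x, p x * fderiv ℝ φ x (u x) =
        ∫ x, (p x * fderiv ℝ φ x (u x) - h x₀ * fderiv ℝ φ x (u x)) := by
      rw [integral_sub hIp (hI1.const_mul _), integral_const_mul, hzero, mul_zero, sub_zero]
    rw [this]
    refine integral_congr_ae (Eventually.of_forall fun x => ?_)
    simp only [hh]
    ring
  have hS₀cpt : IsCompact S₀ :=
    (isCompact_closedBall (0 : EuclideanSpace ℝ (Fin 3)) R).of_isClosed_subset
      ((isClosed_le continuous_const continuous_norm).inter
        (isClosed_le continuous_norm continuous_const)) hS₀sub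
  -- (i) the Laplacian term
  have hT1 : |∫ x, (Δ φ) x * ‖u x‖ ^ 2| ≤ C₂ * R⁻¹ ^ 2 * (a ^ 2 * (R * V₁ ^ (1 / 3 : ℝ))) := by
    have hint2 : IntegrableOn (fun x => ‖u x‖ ^ 2) S₀ :=
      ((huc.norm.pow 2).continuousOn).integrableOn_compact hS₀cpt
    have hb := abs_integral_mul_le_of_bound (K := S₀) (k := fun x => (Δ φ) x)
      (f := fun x => ‖u x‖ ^ 2) (M := C₂ * R⁻¹ ^ 2) hΔφ hvanΔ hint2
    refine hb.trans ?_
    refine mul_le_mul_of_nonneg_left ?_ (by positivity)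
    have hnn : ∫ x in S₀, ‖(‖u x‖ ^ 2 : ℝ)‖ = ∫ x in S₀, ‖u x‖ ^ 2 :=
      integral_congr_ae (Eventually.of_forall fun x => by
        show ‖(‖u x‖ ^ 2 : ℝ)‖ = ‖u x‖ ^ 2
        rw [Real.norm_of_nonneg (sq_nonneg _)])
    rw [hnn]
    refine (setIntegral_norm_sq_le_rpow_three huc hS₀b).trans ?_
    exact mul_le_mul (htwothirdS₀) hVS₀13 (Real.rpow_nonneg measureReal_nonneg _)
      (sq_nonneg a)
  -- (ii) the transport term
  have hT2 : |∫ x, fderiv ℝ φ x (u x) * ‖u x‖ ^ 2| ≤ C₁ * R⁻¹ * a ^ 3 := by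
    have hb := abs_integral_le_setIntegral_of_le (K := S₀) (μ := volume)
      (g := fun x => fderiv ℝ φ x (u x) * ‖u x‖ ^ 2)
      (G := fun x => C₁ * R⁻¹ * ‖u x‖ ^ (3 : ℝ)) (fun x hx => by
        show fderiv ℝ φ x (u x) * ‖u x‖ ^ 2 = 0
        rw [hvanD x hx]; simp) (fun x _ => by
        show |fderiv ℝ φ x (u x) * ‖u x‖ ^ 2| ≤ C₁ * R⁻¹ * ‖u x‖ ^ (3 : ℝ)
        rw [abs_mul, abs_of_nonneg (sq_nonneg ‖u x‖)]
        have h3 : ‖u x‖ ^ (3 : ℝ) = ‖u x‖ * ‖u x‖ ^ 2 := by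
          rw [← Real.rpow_natCast]; norm_num; ring
        rw [h3, ← mul_assoc]
        refine mul_le_mul_of_nonneg_right ?_ (sq_nonneg _)
        rw [← Real.norm_eq_abs]
        exact (ContinuousLinearMap.le_opNorm _ _).trans
          (mul_le_mul_of_nonneg_right (hDφ x) (norm_nonneg _))) hS₀m
      (((continuous_const.mul (huc.norm.rpow_const fun _ => Or.inr (by norm_num))).continuousOn)
        |>.integrableOn_compact hS₀cpt)
    refine hb.trans ?_
    rw [integral_const_mul]
    exact mul_le_mul_of_nonneg_left hmonoS₀ (by positivity)
  -- (iii) the Riesz part of the pressure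
  have hT3 : |∫ x, q x * fderiv ℝ φ x (u x)| ≤ C₁ * R⁻¹ * (P * a) := by
    have hb := abs_integral_le_setIntegral_of_le (K := S₀) (μ := volume)
      (g := fun x => q x * fderiv ℝ φ x (u x))
      (G := fun x => C₁ * R⁻¹ * (|q x| * ‖u x‖)) (fun x hx => by
        show q x * fderiv ℝ φ x (u x) = 0
        rw [hvanD x hx]; simp) (fun x _ => by
        show |q x * fderiv ℝ φ x (u x)| ≤ C₁ * R⁻¹ * (|q x| * ‖u x‖)
        rw [abs_mul, mul_left_comm]
        refine mul_le_mul_of_nonneg_left ?_ (abs_nonneg _)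
        rw [← Real.norm_eq_abs]
        exact (ContinuousLinearMap.le_opNorm _ _).trans
          (mul_le_mul_of_nonneg_right (hDφ x) (norm_nonneg _))) hS₀m
      (((continuous_const.mul ((continuous_abs.comp hqc).mul huc.norm)).continuousOn)
        |>.integrableOn_compact hS₀cpt)
    refine hb.trans ?_
    rw [integral_const_mul]
    refine mul_le_mul_of_nonneg_left ?_ (by positivity)
    refine (setIntegral_mul_norm_le_rpow hqc huc hS₀b).trans ?_
    exact mul_le_mul (hPmonoS₀) (hthirdS₀)
      (Real.rpow_nonneg (setIntegral_norm_rpow_three_nonneg u S₀) _) hP0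
  -- (iv) the harmonic part of the pressure
  have hT4 : |∫ x, (h x - h x₀) * fderiv ℝ φ x (u x)| ≤
      C₁ * R⁻¹ * (G * (4 * R)) * (a * (R ^ 2 * V₁ ^ (1 / (3 / 2) : ℝ))) := by
    have hb := abs_integral_le_setIntegral_of_le (K := S₀) (μ := volume)
      (g := fun x => (h x - h x₀) * fderiv ℝ φ x (u x))
      (G := fun x => C₁ * R⁻¹ * (G * (4 * R)) * ‖u x‖) (fun x hx => by
        show (h x - h x₀) * fderiv ℝ φ x (u x) = 0
        rw [hvanD x hx]; simp) (fun x hx => by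
        show |(h x - h x₀) * fderiv ℝ φ x (u x)| ≤ C₁ * R⁻¹ * (G * (4 * R)) * ‖u x‖
        rw [abs_mul]
        have h1 : |h x - h x₀| ≤ G * (4 * R) := hosc x hx
        have h2 : |fderiv ℝ φ x (u x)| ≤ C₁ * R⁻¹ * ‖u x‖ := by
          rw [← Real.norm_eq_abs]
          exact (ContinuousLinearMap.le_opNorm _ _).trans
            (mul_le_mul_of_nonneg_right (hDφ x) (norm_nonneg _))
        have h3 : |h x - h x₀| * |fderiv ℝ φ x (u x)| ≤ (G * (4 * R)) * (C₁ * R⁻¹ * ‖u x‖) :=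
          mul_le_mul h1 h2 (abs_nonneg _) (by positivity)
        linarith [h3]) hS₀m
      (((continuous_const.mul huc.norm).continuousOn).integrableOn_compact hS₀cpt)
    refine hb.trans ?_
    rw [integral_const_mul]
    refine mul_le_mul_of_nonneg_left ?_ (by positivity)
    refine (setIntegral_norm_le_rpow_three huc hS₀b).trans ?_
    exact mul_le_mul (hthirdS₀) hVS₀23 (Real.rpow_nonneg measureReal_nonneg _) ha0
  ----------------------------------------------------------------
  -- Step 4: add up
  ----------------------------------------------------------------
  rw [henergy, hsplit]
  have habs1 := (abs_le.1 hT1).2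
  have habs2 := (abs_le.1 hT2).2
  have habs3 := (abs_le.1 hT3).2
  have habs4 := (abs_le.1 hT4).2
  linarith

set_option maxHeartbeats 800000 in
-- a long assembly of elementary estimates
/-- **Seregin–Wang 2020, Prop. 2.1 for `q = ℓ = 3` (with Hölder on the annulus).**  There is a
constant `C` such that for every smooth solution `(u, p)` of the steady Navier–Stokes system on
`ℝ³` (`IsLerayProfile 1 0 u p`, `u`, `p` smooth) and every `R > 0`,
`∫_{B(R/2)} |∇u|² ≤ C R⁻¹ (‖u‖²_{L³(A_R)} + ‖u‖³_{L³(A_R)})`, `A_R = {R/2 ≤ |x| < R}` (stated in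
`ℝ≥0∞`, in the form consumed by `sereginWang_liouville_L3_annulus_of_caccioppoli`).  Proof: see
the module docstring (energy identity with the pressure kept, Riesz/harmonic splitting of the
pressure, Stein's `L^{3/2}` bound, interior gradient estimate and shell oscillation for the
harmonic part). [cite: SereginWang2020, Prop. 2.1 and §3] -/
theorem exists_caccioppoli_L3_annulus :
    ∃ C : ℝ≥0, ∀ (u : EuclideanSpace ℝ (Fin 3) → EuclideanSpace ℝ (Fin 3))
      (p : EuclideanSpace ℝ (Fin 3) → ℝ), IsLerayProfile 1 0 u p →
      ContDiff ℝ (⊤ : ℕ∞) u → ContDiff ℝ (⊤ : ℕ∞) p → ∀ R : ℝ, 0 < R →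
        (∫⁻ x in ball (0 : EuclideanSpace ℝ (Fin 3)) (R / 2),
            ENNReal.ofReal (frobeniusNormSq (fderiv ℝ u x))) ≤
          C * (ENNReal.ofReal R⁻¹ *
            (eLpNorm u 3 (volume.restrict
                {x : EuclideanSpace ℝ (Fin 3) | R / 2 ≤ ‖x‖ ∧ ‖x‖ < R}) ^ 2 +
              eLpNorm u 3 (volume.restrict
                {x : EuclideanSpace ℝ (Fin 3) | R / 2 ≤ ‖x‖ ∧ ‖x‖ < R}) ^ 3)) := by
  -- absolute constants
  obtain ⟨K, hK0, hK⟩ := exists_norm_fderiv_harmonicPart_le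
  obtain ⟨CS, hCS⟩ := exists_stein_threeHalves
  obtain ⟨C₁, C₂, hC₁, hC₂, hcut⟩ := exists_energyCutoff (E := EuclideanSpace ℝ (Fin 3))
  set V₁ : ℝ := volume.real (ball (0 : EuclideanSpace ℝ (Fin 3)) 1) with hV₁
  have hV₁0 : 0 ≤ V₁ := measureReal_nonneg
  -- the constants of the gradient bound at scale `R/64` and of the final estimate
  set c₁ : ℝ := 2 ^ 20 * V₁ ^ (1 / (3 / 2) : ℝ) with hc₁
  set c₂ : ℝ := 2 ^ 19 * V₁ ^ (1 / 3 : ℝ) with hc₂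
  set M₂ : ℝ := 2⁻¹ * C₂ * V₁ ^ (1 / 3 : ℝ) + 4 * C₁ * K * V₁ ^ (1 / (3 / 2) : ℝ) * c₁ with hM₂
  set M₃ : ℝ := 2⁻¹ * C₁ + C₁ * CS + 4 * C₁ * K * V₁ ^ (1 / (3 / 2) : ℝ) * c₂ * (1 + CS) with hM₃
  have hc₁0 : 0 ≤ c₁ := by positivity
  have hc₂0 : 0 ≤ c₂ := by positivity
  have hCS0 : (0 : ℝ) ≤ CS := NNReal.coe_nonneg _
  have hM₂0 : 0 ≤ M₂ := by positivity
  have hM₃0 : 0 ≤ M₃ := by positivity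
  refine ⟨(max M₂ M₃).toNNReal, fun u p hprof hu hp R hR => ?_⟩
  -- sets
  set A : Set (EuclideanSpace ℝ (Fin 3)) := {x | R / 2 ≤ ‖x‖ ∧ ‖x‖ < R} with hA
  set S₀ : Set (EuclideanSpace ℝ (Fin 3)) := {x | 3 * R / 4 ≤ ‖x‖ ∧ ‖x‖ ≤ 7 * R / 8} with hS₀
  set U : Set (EuclideanSpace ℝ (Fin 3)) := {x | 5 * R / 8 < ‖x‖ ∧ ‖x‖ < 31 * R / 32} with hU
  have hAsub : A ⊆ closedBall (0 : EuclideanSpace ℝ (Fin 3)) R := fun x hx =>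
    mem_closedBall_zero_iff.2 hx.2.le
  have hAb : IsBounded A := isBounded_closedBall.subset hAsub
  have hAm : MeasurableSet A :=
    (measurableSet_le measurable_const measurable_norm).inter
      (measurableSet_lt measurable_norm measurable_const)
  have hS₀A : S₀ ⊆ A := fun x hx => ⟨by linarith [hx.1], by linarith [hx.2]⟩
  have hS₀sub : S₀ ⊆ closedBall (0 : EuclideanSpace ℝ (Fin 3)) R := hS₀A.trans hAsub
  have hS₀b : IsBounded S₀ := hAb.subset hS₀A
  have hS₀m : MeasurableSet S₀ :=
    (measurableSet_le measurable_const measurable_norm).inter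
      (measurableSet_le measurable_norm measurable_const)
  have hUo : IsOpen U :=
    (isOpen_lt continuous_const continuous_norm).inter (isOpen_lt continuous_norm continuous_const)
  have hS₀U : S₀ ⊆ U := fun x hx => ⟨by linarith [hx.1], by linarith [hx.2]⟩
  -- regularity
  have huc : Continuous u := (contDiff_infty.1 hu 0).continuous
  have hu1 : ContDiff ℝ 1 u := contDiff_infty.1 hu 1
  -- the cut-offs
  obtain ⟨φ, hφs, hφc, hφ01, hφ1, hφ0, hDφ, hΔφ, hφvan⟩ := hcut R hR
  obtain ⟨χ, hχs, hχc, hχ01, hχ1, hχsupp⟩ :=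
    exists_swAnnulusCutoff (E := EuclideanSpace ℝ (Fin 3)) hR
  have hχA : tsupport χ ⊆ A := hχsupp.trans fun x hx => ⟨by linarith [hx.1], by linarith [hx.2]⟩
  have hχU : ∀ y ∈ U, χ y = 1 := fun y hy => hχ1 y hy.1.le hy.2.le
  set w : EuclideanSpace ℝ (Fin 3) → EuclideanSpace ℝ (Fin 3) := fun x => χ x • u x with hw
  set q : EuclideanSpace ℝ (Fin 3) → ℝ := normalisedPressure w with hq
  set h : EuclideanSpace ℝ (Fin 3) → ℝ := fun x => p x - q x with hh
  have hws : ContDiff ℝ ∞ w := hχs.smul hu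
  have hwc : HasCompactSupport w := hχc.smul_right
  have hqs : ContDiff ℝ ∞ q := contDiff_normalisedPressure_of_contDiff_infty hws hwc
  have hqc : Continuous q := (contDiff_infty.1 hqs 0).continuous
  have hhs : ContDiff ℝ ∞ h := contDiff_pressure_sub_normalisedPressure hu hp hχs hχc
  have hhd : Differentiable ℝ h := (contDiff_infty.1 hhs 1).differentiable one_ne_zero
  have hq32 : MemLp q (3 / 2) volume := memLp_normalisedPressure_three_halves hws hwc
  -- the real quantities `a = ‖u‖_{L³(A)}`, `P = ‖q‖_{L^{3/2}}`
  set IA : ℝ := ∫ x in A, ‖u x‖ ^ (3 : ℝ) with hIA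
  set a : ℝ := IA ^ (1 / 3 : ℝ) with ha
  set P : ℝ := (∫ x, |q x| ^ (3 / 2 : ℝ)) ^ (1 / (3 / 2) : ℝ) with hP
  have hIA0 : 0 ≤ IA := setIntegral_norm_rpow_three_nonneg u A
  have ha0 : 0 ≤ a := Real.rpow_nonneg hIA0 _
  have hP0 : 0 ≤ P := Real.rpow_nonneg (integral_nonneg fun _ => Real.rpow_nonneg (abs_nonneg _) _) _
  obtain ⟨ha3, ha2⟩ := rpow_third_pow hIA0
  -- `∫_S |u|³ ≤ a³`-type monotonicity for `S ⊆ A`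
  have hmonoA : ∀ S, S ⊆ A → ∫ x in S, ‖u x‖ ^ (3 : ℝ) ≤ IA := fun S hS =>
    setIntegral_norm_rpow_mono huc hS hAb 3 (by norm_num)
  have hthird : ∀ S, S ⊆ A → (∫ x in S, ‖u x‖ ^ (3 : ℝ)) ^ (1 / 3 : ℝ) ≤ a := fun S hS =>
    Real.rpow_le_rpow (setIntegral_norm_rpow_three_nonneg u S) (hmonoA S hS) (by norm_num)
  have htwothird : ∀ S, S ⊆ A → (∫ x in S, ‖u x‖ ^ (3 : ℝ)) ^ (1 / (3 / 2) : ℝ) ≤ a ^ 2 :=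
    fun S hS => by
    rw [ha2]
    exact Real.rpow_le_rpow (setIntegral_norm_rpow_three_nonneg u S) (hmonoA S hS) (by norm_num)
  have hPmono : ∀ S, (∫ x in S, |q x| ^ (3 / 2 : ℝ)) ^ (1 / (3 / 2) : ℝ) ≤ P := fun S =>
    Real.rpow_le_rpow (integral_nonneg fun _ => Real.rpow_nonneg (abs_nonneg _) _)
      (setIntegral_abs_rpow_le_integral (integrable_abs_rpow_threeHalves hq32) S) (by norm_num)
  -- Stein: `P ≤ CS a²`
  have hN : eLpNorm u 3 (volume.restrict A) = ENNReal.ofReal a :=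
    eLpNorm_three_restrict_eq_ofReal huc hAb
  have hPeq : eLpNorm q (3 / 2) volume = ENNReal.ofReal P := eLpNorm_threeHalves_eq_ofReal hq32
  have hStein : P ≤ CS * a ^ 2 := by
    have h1 : eLpNorm q (3 / 2) volume ≤ CS * eLpNorm u 3 (volume.restrict A) ^ 2 :=
      (hCS w hws hwc).trans (by gcongr; exact eLpNorm_cutoff_smul_le hχ01 hχA u 3)
    rw [hPeq, hN, ← ENNReal.ofReal_pow ha0, ← ENNReal.ofReal_coe_nnreal,
      ← ENNReal.ofReal_mul (NNReal.coe_nonneg _)] at h1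
    exact (ENNReal.ofReal_le_ofReal_iff (by positivity)).1 h1
  -- volumes
  have hVS₀ : volume.real S₀ ≤ R ^ 3 * V₁ := by
    have := volume_real_le_of_subset_closedBall hR.le hS₀sub
    rwa [finrank_euclideanSpace, Fintype.card_fin] at this
  obtain ⟨hVS₀13, hVS₀23⟩ := rpow_le_of_le_cube_mul measureReal_nonneg hR.le hV₁0 hVS₀
  ----------------------------------------------------------------
  -- Step 1: the gradient bound for `h` on the shell `S₀`
  ----------------------------------------------------------------
  set G : ℝ := K * R⁻¹ ^ 3 * (c₁ * a + c₂ * (a ^ 2 + P)) with hG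
  have hG0 : 0 ≤ G := by positivity
  have hgrad : ∀ z, 3 * R / 4 ≤ ‖z‖ → ‖z‖ ≤ 7 * R / 8 → ‖fderiv ℝ h z‖ ≤ G := by
    intro z hz1 hz2
    have := norm_fderiv_harmonicPart_le_on_shell hK0 hK hprof hu hp hχs hχc hR hχU ha0 hP0
      hthird htwothird hPmono hz1 hz2
    rw [hG, hc₁, hc₂]
    exact this
  ----------------------------------------------------------------
  -- Steps 2–4: the real estimate
  ----------------------------------------------------------------
  have hreal0 := energy_real_bound hprof hu hp hχs hχc hR hC₁ hC₂ hφs hφc hDφ hΔφ hφvan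
    ha0 hP0 hG0 (by rw [ha3]; exact hmonoA S₀ hS₀A) (hthird S₀ hS₀A) (htwothird S₀ hS₀A)
    (hPmono S₀) hgrad
  have hreal : ∫ x, φ x * frobeniusNormSq (fderiv ℝ u x) ≤ R⁻¹ * (M₂ * a ^ 2 + M₃ * a ^ 3) := by
    refine hreal0.trans ?_
    rw [hG, hM₂, hM₃, hc₁, hc₂]
    have hR0 : 0 < R⁻¹ := inv_pos.2 hR
    have hPa : P * a ≤ CS * a ^ 2 * a := mul_le_mul_of_nonneg_right hStein ha0
    have hk1 : 0 ≤ 4 * C₁ * K * V₁ ^ (1 / (3 / 2) : ℝ) := by positivity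
    have hk2 : 0 ≤ (2 : ℝ) ^ 19 * V₁ ^ (1 / 3 : ℝ) := by positivity
    have e1 : C₂ * R⁻¹ ^ 2 * (a ^ 2 * (R * V₁ ^ (1 / 3 : ℝ))) =
        R⁻¹ * (C₂ * V₁ ^ (1 / 3 : ℝ) * a ^ 2) := by
      field_simp
    have e4 : C₁ * R⁻¹ * (K * R⁻¹ ^ 3 * (2 ^ 20 * V₁ ^ (1 / (3 / 2) : ℝ) * a +
        2 ^ 19 * V₁ ^ (1 / 3 : ℝ) * (a ^ 2 + P)) * (4 * R)) *
          (a * (R ^ 2 * V₁ ^ (1 / (3 / 2) : ℝ))) =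
        R⁻¹ * (4 * C₁ * K * V₁ ^ (1 / (3 / 2) : ℝ) * (2 ^ 20 * V₁ ^ (1 / (3 / 2) : ℝ) * a ^ 2 +
          2 ^ 19 * V₁ ^ (1 / 3 : ℝ) * (a ^ 3 + P * a))) := by
      field_simp
    rw [e1, e4]
    nlinarith [mul_le_mul_of_nonneg_left hPa (mul_nonneg hR0.le hC₁),
      mul_le_mul_of_nonneg_left hPa (mul_nonneg hR0.le (mul_nonneg hk1 hk2))]
  ----------------------------------------------------------------
  -- Step 5: conversion to `ℝ≥0∞`
  ----------------------------------------------------------------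
  set F : EuclideanSpace ℝ (Fin 3) → ℝ := fun x => frobeniusNormSq (fderiv ℝ u x) with hF
  have hF0 : ∀ x, 0 ≤ F x := fun x => frobeniusNormSq_nonneg _
  have hFc : Continuous F := by
    have : F = fun x => ∑ i, ‖fderiv ℝ u x (stdOrthonormalBasis ℝ _ i)‖ ^ 2 :=
      funext fun x => frobeniusNormSq_eq_sum (stdOrthonormalBasis ℝ _) _
    rw [this]
    exact continuous_finsetSum _ fun i _ =>
      (((hu1.continuous_fderiv one_ne_zero).clm_apply continuous_const).norm).pow 2
  have hφcn : Continuous φ := (contDiff_infty.1 hφs 0).continuous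
  have hφF : Integrable fun x => φ x * F x :=
    (hφcn.mul hFc).integrable_of_hasCompactSupport hφc.mul_right
  have hφF0 : ∀ x, 0 ≤ φ x * F x := fun x => mul_nonneg (hφ01 x).1 (hF0 x)
  have hLHS : (∫⁻ x in ball (0 : EuclideanSpace ℝ (Fin 3)) (R / 2), ENNReal.ofReal (F x)) ≤
      ENNReal.ofReal (∫ x, φ x * F x) := by
    rw [ofReal_integral_eq_lintegral_ofReal hφF (Eventually.of_forall hφF0)]
    calc (∫⁻ x in ball (0 : EuclideanSpace ℝ (Fin 3)) (R / 2), ENNReal.ofReal (F x))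
        = ∫⁻ x in ball (0 : EuclideanSpace ℝ (Fin 3)) (R / 2), ENNReal.ofReal (φ x * F x) := by
          refine setLIntegral_congr_fun measurableSet_ball fun x hx => ?_
          rw [hφ1 x (by rw [mem_ball_zero_iff] at hx; linarith), one_mul]
      _ ≤ ∫⁻ x, ENNReal.ofReal (φ x * F x) := setLIntegral_le_lintegral _ _
  refine hLHS.trans ?_
  have hmax : M₂ * a ^ 2 + M₃ * a ^ 3 ≤ max M₂ M₃ * (a ^ 2 + a ^ 3) := by
    nlinarith [le_max_left M₂ M₃, le_max_right M₂ M₃, sq_nonneg a, pow_nonneg ha0 3]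
  have hfin : ∫ x, φ x * F x ≤ max M₂ M₃ * (R⁻¹ * (a ^ 2 + a ^ 3)) := by
    refine hreal.trans ?_
    rw [mul_left_comm]
    exact mul_le_mul_of_nonneg_left hmax (inv_nonneg.2 hR.le)
  calc ENNReal.ofReal (∫ x, φ x * F x)
      ≤ ENNReal.ofReal (max M₂ M₃ * (R⁻¹ * (a ^ 2 + a ^ 3))) := ENNReal.ofReal_le_ofReal hfin
    _ = (max M₂ M₃).toNNReal * (ENNReal.ofReal R⁻¹ *
          (ENNReal.ofReal a ^ 2 + ENNReal.ofReal a ^ 3)) := by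
        rw [ENNReal.ofReal_mul (le_max_of_le_left hM₂0), ENNReal.ofReal_mul (inv_nonneg.2 hR.le),
          ENNReal.ofReal_add (sq_nonneg a) (pow_nonneg ha0 3), ENNReal.ofReal_pow ha0,
          ENNReal.ofReal_pow ha0]
        rfl
    _ = _ := by rw [hN]

/-- **Discharge of `sereginWang_liouville_L3_annulus` (Seregin–Wang 2020, Thm 1.1 (i),
`q = ℓ = 3`).**  From the Caccioppoli-type inequality `exists_caccioppoli_L3_annulus`
(ibid., Prop. 2.1 with Hölder on the annulus) and the printed §3 reduction
`sereginWang_liouville_L3_annulus_of_caccioppoli`. [cite: SereginWang2020, Thm 1.1 (i)] -/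
theorem sereginWang_liouville_L3_annulus_holds : sereginWang_liouville_L3_annulus :=
  sereginWang_liouville_L3_annulus_of_caccioppoli exists_caccioppoli_L3_annulus

end Literature.Analysis.FluidPDE

end
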